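import Literature.MathematicalPhysics.QuantumLattice.PairWordDysonSeries
import Literature.MathematicalPhysics.QuantumLattice.VacuumLinkedCluster
import HarnessLib

/-!
# The linked-cluster recursion for the word expansion (`log Z`, mixed vertices, ordered-integral form)

Topic `MathematicalPhysics/QuantumLattice`; the generic companion of `VacuumLinkedCluster.lean` (there:
on-site quartic vertices `n_{x↑}n_{x↓}` only). For the Dyson series of
`Tr e^{-β(dΓ(h) + g Σ_r v_r W_r)} = Σ_k g^k b_k` in determinant form (`PairWordDysonSeries`:
letters `W_r = ∏_{q<p} c†_{op r q} c_{om r q}` of a common pair count `p`, weights `v_r`,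
`b_k = ∫_{Δ_k} (-β)^k Σ_{f : [k] → R} (∏_i v_{f i}) Z₀ det G_f(-βu) du`), peeling off the truncated
expectation of the block of vertices containing a PINNED vertex (`sum_ursellOf_mul_eq` for the
determinant moments over the vertex clusters `wordCluster`), re-indexing blocks along the pair
embeddings `wordPairMap` (functoriality of moments / Ursell functions), splitting the weights and the
letter sums over the block and its complement, averaging over the pinned vertex and shuffling the
ordered time integrals gives the **linked-cluster recursion**

`k · b_k = Σ_{j+m=k} j · c_j · b_m`,
`c_j = ∫_{Δ_j} (-β)^j Σ_{g : [j] → R} (∏_i v_{g i}) 𝓔ᵀ(W_{g 0}(s_0); …; W_{g (j-1)}(s_{j-1})) dv`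

(`word_linkedCluster_recursion`) — the combinatorial half of `log Z = log Z₀ + Σ_j g^j c_j` for MIXED
words (quadratic counterterm/source vertices and quartic interaction vertices expanded jointly,
Benfatto–Giuliani–Mastropietro 2006 §2.2 (2.13)–(2.16); Brydges 1986 §2; Mastropietro 2008 (2.35)–(2.36)).

* `wordCluster`, `wordCluster_wordPairMap`, `prod_eq_prod_tupleOn_mul` — bookkeeping;
* `det_wordPropMatrix_eq_sum_pinned` — `det G_f = Σ_{S ∋ i₀} 𝓔ᵀ_{|S|}(f|_S) · det G_{f|_{Sᶜ}}`;
* `wordUrsellIntegrand`, `continuous_wordUrsellIntegrand` — the weighted connected integrand `C_j`;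
* `wordIntegrand_eq_sum_pinned`, `mul_wordIntegrand_eq_sum` — `k · B_k(u) = Σ_S |S| C_{|S|}(u|_S) B_{|Sᶜ|}(u|_{Sᶜ})`;
* **`word_linkedCluster_recursion`** — `k b_k = Σ_{j+m=k} j c_j b_m`.

Everything is PROVED; the definitions are the cluster map and the connected integrand.

## References
* D. C. Brydges, *A short course on cluster expansions*, Les Houches 1984, §2. [cite: Brydges1986, §2]
* G. Benfatto, A. Giuliani, V. Mastropietro, Ann. Henri Poincaré 7 (2006) 809–898, §2.2 (2.13)–(2.16).
  [cite: BenfattoGiulianiMastropietro2006, §2.2 (2.13)]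
* V. Mastropietro, *Non-Perturbative Renormalization* (2008), §2.3 (2.35)–(2.36). [cite: Mastropietro2008, §2.3]
-/

noncomputable section

open scoped Matrix.Norms.L2Operator ComplexOrder
open Finset MeasureTheory intervalIntegral Filter Topology NormedSpace
open Literature.Probability.LatticeModels (ursellOf)

namespace Literature.MathematicalPhysics.QuantumLattice

/-! ### The vertex clusters of a word -/

section Clusters

variable {p j k : ℕ}

/-- **The cluster map of a word with `p` pairs per letter**: pair `(i, q)` belongs to vertex `i`.
[folklore] -/
def wordCluster (p m : ℕ) : Fin (m * p) → Fin m := fun a => (finProdFinEquiv.symm a).1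

/-- Unfolding `wordCluster`. [folklore] -/
@[simp] theorem wordCluster_apply (p m : ℕ) (a : Fin (m * p)) :
    wordCluster p m a = (finProdFinEquiv.symm a).1 := rfl

/-- The vertex of a re-indexed pair is the image vertex. [folklore] -/
theorem wordCluster_wordPairMap (e : Fin j → Fin k) (a : Fin (j * p)) :
    wordCluster p k (wordPairMap e a) = e (wordCluster p j a) := by
  simp only [wordCluster, finProdFinEquiv_symm_wordPairMap]

/-- Every vertex carries exactly `p` pairs. [folklore] -/
theorem card_fieldsOf_wordCluster_singleton (p j : ℕ) (x : Fin j) :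
    (FermionicTree.fieldsOf (wordCluster p j) {x}).card = p := by
  have hset : FermionicTree.fieldsOf (wordCluster p j) {x} =
      univ.filter fun a : Fin (j * p) => (finProdFinEquiv.symm a).1 = x := by
    ext a
    simp [FermionicTree.mem_fieldsOf]
  rw [hset, card_filter_pairVertex_eq]

/-- **Products over the letters split along a block and its complement**:
`∏_i φ(u_i) = (∏_{i'} φ((u|_S)_{i'})) · ∏_{i'} φ((u|_{Sᶜ})_{i'})`. [folklore] -/
theorem prod_eq_prod_tupleOn_mul {M : Type*} [CommMonoid M] {X : Type*} {n : ℕ} (S : Finset (Fin n))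
    (φ : X → M) (u : Fin n → X) :
    ∏ i, φ (u i) = (∏ i, φ (tupleOn S rfl u i)) * ∏ i, φ (tupleOn Sᶜ rfl u i) := by
  rw [← Finset.prod_mul_prod_compl S (fun i => φ (u i))]
  congr 1
  · conv_lhs => rw [eq_map_orderEmbOfFin_univ S]
    rw [Finset.prod_map]
    rfl
  · conv_lhs => rw [eq_map_orderEmbOfFin_univ Sᶜ]
    rw [Finset.prod_map]
    rfl

end Clusters

/-! ### The pinned block decomposition of the word determinant -/

section Pinned

variable {κ : Type*} [LinearOrder κ] [Fintype κ] (β : ℝ) (h : Matrix κ κ ℂ)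
variable {R : Type*} {p : ℕ} (op om : R → Fin p → κ)

/-- **The pinned block (linked-cluster) decomposition of the word determinant**: for every vertex `i₀`,
`det G_f = Σ_{S ∋ i₀} 𝓔ᵀ_{|S|}(f|_S, s|_S) · det G_{f|_{Sᶜ}, s|_{Sᶜ}}`, the truncated expectation being the
Ursell function, over the vertex clusters, of the determinant moments of the word propagator matrix.
Brydges 1986 §2; BGM 2006 (2.13)–(2.16). [cite: BenfattoGiulianiMastropietro2006, §2.2 (2.13)] -/
theorem det_wordPropMatrix_eq_sum_pinned {k : ℕ} (f : Fin k → R) (s : Fin k → ℂ) (i₀ : Fin k) :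
    (wordPropMatrix β h op om f s).det =
      ∑ S ∈ (univ : Finset (Fin k)).powerset.filter (fun S => i₀ ∈ S),
        ursellOf (FermionicTree.moment (wordCluster p S.card)
            (wordPropMatrix β h op om (tupleOn S rfl f) (tupleOn S rfl s))) univ *
          (wordPropMatrix β h op om (tupleOn Sᶜ rfl f) (tupleOn Sᶜ rfl s)).det := by
  set M := wordPropMatrix β h op om f s with hM
  rw [← FermionicTree.moment_univ (wordCluster p k) M,
    ← Literature.Probability.LatticeModels.sum_ursellOf_mul_eq
      (FermionicTree.moment (wordCluster p k) M) (FermionicTree.moment_empty _ _) (Finset.mem_univ i₀)]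
  refine Finset.sum_congr rfl fun S _ => ?_
  congr 1
  · -- the block of `i₀`: truncated expectation of the `|S|`-vertex word
    conv_lhs => rw [eq_map_orderEmbOfFin_univ S]
    rw [FermionicTree.ursellOf_moment_map_eq (wordCluster p k) M (wordCluster p S.card)
        (OrderEmbedding.ofStrictMono (wordPairMap (p := p) (S.orderEmbOfFin rfl))
          (wordPairMap_strictMono (S.orderEmbOfFin rfl).strictMono))
        (S.orderEmbOfFin rfl).toEmbedding
        (fun a' => by
          rw [OrderEmbedding.coe_ofStrictMono, wordCluster_wordPairMap]; rfl)
        (fun a ha => mem_range_wordPairMap _ a ha),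
      hM, wordPropMatrix_submatrix_wordPairMap]
    rfl
  · -- the remaining vertices: the moment of the `|Sᶜ|`-vertex word
    rw [← Finset.compl_eq_univ_sdiff]
    conv_lhs => rw [eq_map_orderEmbOfFin_univ Sᶜ]
    rw [FermionicTree.moment_map_eq (wordCluster p k) M (wordCluster p Sᶜ.card)
        (OrderEmbedding.ofStrictMono (wordPairMap (p := p) (Sᶜ.orderEmbOfFin rfl))
          (wordPairMap_strictMono (Sᶜ.orderEmbOfFin rfl).strictMono))
        (Sᶜ.orderEmbOfFin rfl).toEmbedding
        (fun a' => by
          rw [OrderEmbedding.coe_ofStrictMono, wordCluster_wordPairMap]; rfl)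
        (fun a ha => mem_range_wordPairMap _ a ha),
      FermionicTree.moment_univ, hM, wordPropMatrix_submatrix_wordPairMap]
    rfl

/-! ### The integrands -/

variable [Fintype R] (v : R → ℂ)

/-- **The weighted connected (Ursell) integrand of order `j`**:
`C_j(w) = (-β)^j Σ_{g : [j] → R} (∏_i v_{g i}) 𝓔ᵀ(W_{g 0}(s_0); …; W_{g (j-1)}(s_{j-1}))`, `s_i = -β w_i`,
the truncated expectation being the Ursell function of the determinant moments of the word over its
vertex clusters. [cite: BenfattoGiulianiMastropietro2006, §2.2 (2.14)] -/
def wordUrsellIntegrand (j : ℕ) : (Fin j → ℝ) → ℂ := fun w =>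
  (-(β : ℂ)) ^ j * ∑ g : Fin j → R, (∏ i, v (g i)) *
    ursellOf (FermionicTree.moment (wordCluster p j)
      (wordPropMatrix β h op om g (fun i => ((w i : ℝ) : ℂ) * -(β : ℂ)))) univ

/-- The weighted connected integrand is continuous. [folklore] -/
theorem continuous_wordUrsellIntegrand (j : ℕ) : Continuous (wordUrsellIntegrand β h op om v j) := by
  unfold wordUrsellIntegrand
  refine continuous_const.mul (continuous_finsetSum _ fun g _ => continuous_const.mul ?_)
  refine FermionicTree.continuous_ursellOf
    (fun (w : Fin j → ℝ) P => FermionicTree.moment (wordCluster p j)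
      (wordPropMatrix β h op om g (fun i => ((w i : ℝ) : ℂ) * -(β : ℂ))) P) (fun P => ?_) _
  exact FermionicTree.continuous_moment (wordCluster p j) _
    (fun a b => continuous_wordPropMatrix_apply β h op om g a b) P

/-- **The word integrand splits into connected and full parts over the blocks containing a pinned
vertex**: `B_k(u) = Σ_{S ∋ i₀} C_{|S|}(u|_S) · B_{|Sᶜ|}(u|_{Sᶜ})` (the weights `∏_i v_{f i}` factor over
the block and its complement). [folklore] -/
theorem wordIntegrand_eq_sum_pinned (Z₀ : ℂ) {k : ℕ} (u : Fin k → ℝ) (i₀ : Fin k) :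
    wordIntegrand β h op om v Z₀ k u =
      ∑ S ∈ (univ : Finset (Fin k)).powerset.filter (fun S => i₀ ∈ S),
        wordUrsellIntegrand β h op om v S.card (tupleOn S rfl u) *
          wordIntegrand β h op om v Z₀ Sᶜ.card (tupleOn Sᶜ rfl u) := by
  have hk : ∀ S : Finset (Fin k), (-(β : ℂ)) ^ k = (-(β : ℂ)) ^ S.card * (-(β : ℂ)) ^ Sᶜ.card := by
    intro S
    rw [← pow_add, Finset.card_add_card_compl, Fintype.card_fin]
  unfold wordIntegrand wordUrsellIntegrand
  -- abbreviations for the block functions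
  set Φ : (S : Finset (Fin k)) → (Fin S.card → R) → ℂ := fun S g => (∏ i, v (g i)) *
    ursellOf (FermionicTree.moment (wordCluster p S.card)
      (wordPropMatrix β h op om g (fun i => (((tupleOn S rfl u) i : ℝ) : ℂ) * -(β : ℂ)))) univ with hΦ
  set Ψ : (S : Finset (Fin k)) → (Fin Sᶜ.card → R) → ℂ := fun S g => (∏ i, v (g i)) *
    (Z₀ * (wordPropMatrix β h op om g (fun i => (((tupleOn Sᶜ rfl u) i : ℝ) : ℂ) * -(β : ℂ))).det) with hΨ
  have step1 : ∀ f : Fin k → R,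
      (∏ i, v (f i)) * (Z₀ * (wordPropMatrix β h op om f (fun i => ((u i : ℝ) : ℂ) * -(β : ℂ))).det) =
        ∑ S ∈ (univ : Finset (Fin k)).powerset.filter (fun S => i₀ ∈ S),
          Φ S (tupleOn S rfl f) * Ψ S (tupleOn Sᶜ rfl f) := by
    intro f
    rw [det_wordPropMatrix_eq_sum_pinned β h op om f _ i₀, Finset.mul_sum, Finset.mul_sum]
    refine Finset.sum_congr rfl fun S _ => ?_
    rw [prod_eq_prod_tupleOn_mul S v f]
    simp only [hΦ, hΨ]
    have e1 : (tupleOn S rfl fun i => ((u i : ℝ) : ℂ) * -(β : ℂ)) =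
        fun i => (((tupleOn S rfl u) i : ℝ) : ℂ) * -(β : ℂ) := rfl
    have e2 : (tupleOn Sᶜ rfl fun i => ((u i : ℝ) : ℂ) * -(β : ℂ)) =
        fun i => (((tupleOn Sᶜ rfl u) i : ℝ) : ℂ) * -(β : ℂ) := rfl
    rw [e1, e2]
    ring
  simp_rw [step1]
  rw [Finset.sum_comm, Finset.mul_sum]
  refine Finset.sum_congr rfl fun S _ => ?_
  rw [sum_tupleOn_mul_tupleOn (X := R) S rfl rfl (Φ S) (Ψ S), hk S]
  simp only [hΦ, hΨ]
  ring

/-- **Averaging over the pinned vertex**: `k · B_k(u) = Σ_{S ⊆ [k]} |S| · C_{|S|}(u|_S) · B_{|Sᶜ|}(u|_{Sᶜ})`.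
[folklore] -/
theorem mul_wordIntegrand_eq_sum (Z₀ : ℂ) {k : ℕ} (u : Fin k → ℝ) :
    (k : ℂ) * wordIntegrand β h op om v Z₀ k u =
      ∑ S : Finset (Fin k),
        ((S.card : ℂ) * wordUrsellIntegrand β h op om v S.card (tupleOn S rfl u)) *
          wordIntegrand β h op om v Z₀ Sᶜ.card (tupleOn Sᶜ rfl u) := by
  classical
  have hsum : ∑ _i₀ : Fin k, wordIntegrand β h op om v Z₀ k u = (k : ℂ) * wordIntegrand β h op om v Z₀ k u := by
    rw [Finset.sum_const, Finset.card_univ, Fintype.card_fin, nsmul_eq_mul]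
  rw [← hsum, Finset.sum_congr rfl fun i₀ _ => wordIntegrand_eq_sum_pinned β h op om v Z₀ u i₀]
  rw [Finset.sum_comm' (t' := univ)
    (s' := fun S : Finset (Fin k) => univ.filter fun i₀ : Fin k => i₀ ∈ S)
    (h := fun i₀ S => by simp)]
  refine Finset.sum_congr rfl fun S _ => ?_
  rw [Finset.sum_const, nsmul_eq_mul, Finset.filter_mem_eq_inter, Finset.univ_inter]
  ring

/-! ### The recursion -/

/-- **The linked-cluster recursion for the word expansion** (ordered-integral form of `Z' = C' Z`, i.e.
of `log Z = log Z₀ + Σ_j g^j c_j`, for mixed words): with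
`b_m = ∫_{Δ_m} (-β)^m Σ_f (∏ v_{f i}) Z₀ det G_f(-βw) dw` (`wordIntegrand`) and the weighted connected
coefficients `c_j = ∫_{Δ_j} C_j` (`wordUrsellIntegrand`), `k · b_k = Σ_{j+m=k} j · c_j · b_m` for every `k`.
Brydges 1986 §2; BGM 2006 (2.13); Mastropietro 2008 (2.35)–(2.36). [cite: Brydges1986, §2] -/
theorem word_linkedCluster_recursion (Z₀ : ℂ) (k : ℕ) :
    (k : ℂ) * orderedIntegral k (wordIntegrand β h op om v Z₀ k) 1 =
      ∑ q ∈ antidiagonal k, (q.1 : ℂ) *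
        orderedIntegral q.1 (wordUrsellIntegrand β h op om v q.1) 1 *
          orderedIntegral q.2 (wordIntegrand β h op om v Z₀ q.2) 1 := by
  set F : (j : ℕ) → (Fin j → ℝ) → ℂ := fun j w => wordUrsellIntegrand β h op om v j w * (j : ℂ) with hF
  have hFcont : ∀ j, Continuous (F j) := fun j =>
    (continuous_wordUrsellIntegrand β h op om v j).mul continuous_const
  have hfun : (fun u : Fin k → ℝ => (k : ℂ) * wordIntegrand β h op om v Z₀ k u) = fun u =>
      ∑ S : Finset (Fin k), F S.card (tupleOn S rfl u) *
        wordIntegrand β h op om v Z₀ Sᶜ.card (tupleOn Sᶜ rfl u) := by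
    funext u
    rw [mul_wordIntegrand_eq_sum β h op om v Z₀ u]
    refine Finset.sum_congr rfl fun S _ => ?_
    simp only [hF]
    ring
  have hlhs : (k : ℂ) * orderedIntegral k (wordIntegrand β h op om v Z₀ k) 1 =
      orderedIntegral k (fun u : Fin k → ℝ => (k : ℂ) * wordIntegrand β h op om v Z₀ k u) 1 := by
    rw [mul_comm, ← orderedIntegral_mul_const]
    congr 1
    funext u
    ring
  rw [hlhs, hfun, orderedIntegral_sum_tupleOn_mul k F (wordIntegrand β h op om v Z₀) hFcont
    (continuous_wordIntegrand β h op om v Z₀) 1]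
  refine Finset.sum_congr rfl fun q _ => ?_
  simp only [hF]
  rw [orderedIntegral_mul_const]
  ring

end Pinned

end Literature.MathematicalPhysics.QuantumLattice
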